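import Literature.Probability.Distributions.GaussianSphereMarginal
import Literature.MathematicalPhysics.KineticTheory.HardSphereEuler
import HarnessLib

/-!
# Archimedes' hat-box theorem for the standard Gaussian of `ℝ³`

Helper file (`--supports`) of the crux `LambertianContactSwap.LambertianEuler`
(stmt-AtomisticToContinuum-11854), line `Sketch`, stub `stub_archimedes`.

For a unit vector `e ∈ ℝ³` and a standard Gaussian vector `ξ ∈ ℝ³`, the cosine
`⟪e, ξ⟫/‖ξ‖` of the angle between `e` and `ξ` — i.e. between `e` and the uniformly distributed
point `ξ/‖ξ‖` of the unit sphere — is uniformly distributed on `[-1, 1]` (Archimedes' hat-box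
theorem: the axial projection of the uniform law of `S²` is uniform). In `lintegral` form:

* `archimedesV3` — `∫⁻ G(⟪e, ξ⟫/‖ξ‖) dγ(ξ) = ½ ∫⁻_{[-1,1]} G` for measurable `G ≥ 0`
  (the registered stub signature, stated over `V3 = EuclideanSpace ℝ (Fin 3)`);
* `radialArchimedes` — the same law in the radial coordinates `(x, r)`, `x ∼ N(0,1)` the axial
  coordinate and `r = ‖y‖` the norm of an independent standard Gaussian `y ∈ ℝ²` (law
  `r e^{-r²/2} dr` on `(0, ∞)`):
  `∫⁻ (∫⁻_{r>0} r e^{-r²/2} G(x/√(x²+r²)) dr) dγ₁(x) = ½ ∫⁻_{[-1,1]} G`;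
* `lintegral_gaussianReal_stdGaussian_two_archimedes` — the common middle form
  `∫⁻∫⁻ G(x/√(x² + ‖y‖²)) dγ_{ℝ²}(y) dγ₁(x) = ½ ∫⁻_{[-1,1]} G`.

Proof: the middle form is the case `E₁ = ℝ`, `F = ℝ²` of the tree's sphere-marginal (beta) law
`Literature.Probability.Distributions.lintegral_comp_sphereMarginalMap` (density
`∝ (1 - b²)^{d/2-1} 𝟙_{|b|<1}` with `d = 2`, i.e. constant on `(-1, 1)`), the constant `½` being
fixed by total mass; `archimedesV3` reduces to it in the coordinates of an orthonormal basis of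
`ℝ³` through `e` (`stdGaussian_eq_map_pi_orthonormalBasis`, `measurePreserving_piFinSuccAbove`,
`map_pi_eq_stdGaussian`), and `radialArchimedes` through the `χ²₂` law of `‖y‖²`
(`lintegral_comp_norm_sq_stdGaussian`) and the substitution `t = r²`.

References: Archimedes, *On the Sphere and Cylinder* I; Muirhead, *Aspects of multivariate
statistical theory*, Thm. 1.5.7 (ii). All [folklore].
-/

noncomputable section

namespace Summit.AtomisticToContinuum.HydrodynamicLimit.Theorems.LambertianContactSwapLambertianEulerArchimedes

open scoped ENNReal InnerProductSpace
open MeasureTheory ProbabilityTheory Set Real Module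
open Literature.Probability.Distributions
open Literature.MathematicalPhysics.KineticTheory (V3)

/-! ### One-dimensional bookkeeping -/

/-- Mathlib's standard Gaussian of the inner product space `ℝ` is `gaussianReal 0 1`
(same characteristic function `e^{-t²/2}`). [folklore] -/
theorem stdGaussian_real_eq_gaussianReal : stdGaussian ℝ = gaussianReal 0 1 := by
  apply Measure.ext_of_charFun
  funext t
  rw [charFun_stdGaussian, charFun_gaussianReal]
  congr 1
  have h : (‖t‖ : ℂ) ^ 2 = (t : ℂ) ^ 2 := by
    rw [← Complex.ofReal_pow, ← Complex.ofReal_pow, Real.norm_eq_abs, sq_abs]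
  rw [h]
  push_cast
  ring

/-- `ℝ²` is nontrivial. [folklore] -/
theorem nontrivial_euclideanSpace_two : Nontrivial (EuclideanSpace ℝ (Fin 2)) :=
  Module.nontrivial_of_finrank_pos (R := ℝ) (by simp)

/-- The sphere-marginal density of the tree with `d = 2` is the indicator of `(-1, 1)`:
`G b · (1 - b²)^{2/2-1} 𝟙_{|b|<1} = 𝟙_{(-1,1)}(b) G b`. [folklore] -/
theorem mul_sphereMarginalDensity_two (G : ℝ → ℝ≥0∞) (b : ℝ) :
    G b * ENNReal.ofReal (sphereMarginalDensity (E₁ := ℝ) 2 b) =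
      (Ioo (-1 : ℝ) 1).indicator G b := by
  rw [sphereMarginalDensity]
  by_cases hb : b ∈ Ioo (-1 : ℝ) 1
  · have hb' : ‖b‖ < 1 := by rw [Real.norm_eq_abs, abs_lt]; exact hb
    rw [if_pos hb', indicator_of_mem hb, show ((2 : ℕ) : ℝ) / 2 - 1 = 0 by norm_num,
      Real.rpow_zero, ENNReal.ofReal_one, mul_one]
  · have hb' : ¬ ‖b‖ < 1 := by rw [Real.norm_eq_abs, abs_lt]; exact hb
    rw [if_neg hb', indicator_of_notMem hb, ENNReal.ofReal_zero, mul_zero]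

/-! ### The middle form: axial Gaussian coordinate against an independent planar Gaussian -/

/-- **Archimedes in Gaussian coordinates `(x, y) ∈ ℝ × ℝ²`.** For a standard Gaussian `x ∈ ℝ`
and an independent standard Gaussian `y ∈ ℝ²`, the first coordinate `x/√(x² + ‖y‖²)` of the
uniform point `(x, y)/‖(x, y)‖` of `S²` is uniform on `[-1, 1]`:
`∫⁻∫⁻ G(x/√(x² + ‖y‖²)) dγ_{ℝ²}(y) dγ₁(x) = ½ ∫⁻_{[-1,1]} G` for measurable `G ≥ 0`. The case
`E₁ = ℝ`, `F = ℝ²` of `lintegral_comp_sphereMarginalMap`, the constant fixed by `G ≡ 1`.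
[folklore] -/
theorem lintegral_gaussianReal_stdGaussian_two_archimedes (G : ℝ → ℝ≥0∞) (hG : Measurable G) :
    ∫⁻ x, ∫⁻ y, G (x / √(x ^ 2 + ‖y‖ ^ 2)) ∂(stdGaussian (EuclideanSpace ℝ (Fin 2)))
      ∂(gaussianReal 0 1) = 2⁻¹ * ∫⁻ t in Icc (-1 : ℝ) 1, G t := by
  haveI : Nontrivial (EuclideanSpace ℝ (Fin 2)) := nontrivial_euclideanSpace_two
  have hd : finrank ℝ (EuclideanSpace ℝ (Fin 2)) = 2 := by simp
  set K : ℝ≥0∞ := ∫⁻ s in Ioi (0 : ℝ),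
    ENNReal.ofReal (sphereWeight (E₁ := ℝ) (F := EuclideanSpace ℝ (Fin 2)) s) with hK
  -- the identity with the tree's (unnamed) constant
  have key : ∀ G : ℝ → ℝ≥0∞, Measurable G →
      ∫⁻ x, ∫⁻ y, G (x / √(x ^ 2 + ‖y‖ ^ 2)) ∂(stdGaussian (EuclideanSpace ℝ (Fin 2)))
        ∂(gaussianReal 0 1) = K * ∫⁻ t in Icc (-1 : ℝ) 1, G t := by
    intro G hG
    have h := lintegral_comp_sphereMarginalMap (E₁ := ℝ) (F := EuclideanSpace ℝ (Fin 2)) hG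
    rw [stdGaussian_real_eq_gaussianReal,
      lintegral_prod (fun p : ℝ × EuclideanSpace ℝ (Fin 2) =>
          G (sphereMarginalMap ℝ (EuclideanSpace ℝ (Fin 2)) p))
        ((hG.comp measurable_sphereMarginalMap).aemeasurable), hd] at h
    have hlhs : ∀ (x : ℝ) (y : EuclideanSpace ℝ (Fin 2)),
        sphereMarginalMap ℝ (EuclideanSpace ℝ (Fin 2)) (x, y) = x / √(x ^ 2 + ‖y‖ ^ 2) := by
      intro x y
      simp only [sphereMarginalMap, smul_eq_mul, Real.norm_eq_abs, sq_abs]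
      rw [inv_mul_eq_div]
    simp_rw [hlhs, mul_sphereMarginalDensity_two] at h
    rw [h, ← hK, lintegral_indicator measurableSet_Ioo]
    congr 1
    exact setLIntegral_congr Ioo_ae_eq_Icc
  -- the constant from total mass
  have hmass := key (fun _ => 1) measurable_const
  simp only [lintegral_const, measure_univ, mul_one, one_mul,
    Measure.restrict_apply MeasurableSet.univ, univ_inter, Real.volume_Icc] at hmass
  have h2 : K * 2 = 1 := by
    rw [hmass, show (1 : ℝ) - -1 = 2 by norm_num, ENNReal.ofReal_ofNat]
  rw [key G hG, ENNReal.eq_inv_of_mul_eq_one_left h2]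

/-! ### The radial form -/

/-- **Radial law of the planar standard Gaussian**, `lintegral` transfer form: for measurable
`H ≥ 0`, `∫⁻ H(‖y‖²) dγ_{ℝ²}(y) = ∫⁻_{r>0} r e^{-r²/2} H(r²) dr` (the `χ²₂` law
`½ e^{-t/2} dt` of `‖y‖²`, `lintegral_comp_norm_sq_stdGaussian` with `d = 2`, and the
substitution `t = r²`). [folklore] -/
theorem lintegral_comp_norm_sq_stdGaussian_two (H : ℝ → ℝ≥0∞) (hH : Measurable H) :
    ∫⁻ y, H (‖y‖ ^ 2) ∂(stdGaussian (EuclideanSpace ℝ (Fin 2))) =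
      ∫⁻ r in Ioi (0 : ℝ), ENNReal.ofReal (r * rexp (-r ^ 2 / 2)) * H (r ^ 2) := by
  haveI : Nontrivial (EuclideanSpace ℝ (Fin 2)) := nontrivial_euclideanSpace_two
  rw [lintegral_comp_norm_sq_stdGaussian H hH]
  have hd : (finrank ℝ (EuclideanSpace ℝ (Fin 2)) : ℝ) = 2 := by simp
  have hdens : ∀ t : ℝ, normSqDensity (EuclideanSpace ℝ (Fin 2)) t = 1 / 2 * rexp (-t / 2) := by
    intro t
    rw [normSqDensity, normSqConst_eq, hd, show (2 : ℝ) / 2 = 1 by norm_num, Real.rpow_one,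
      Real.Gamma_one, sub_self, Real.rpow_zero, div_one, one_mul]
  simp_rw [hdens]
  -- the substitution `t = r²`
  have hderiv : ∀ r ∈ Ioi (0 : ℝ), HasDerivWithinAt (fun r : ℝ => r ^ 2) (2 * r) (Ioi 0) r := by
    intro r _
    simpa using (hasDerivAt_pow 2 r).hasDerivWithinAt
  have hinj : InjOn (fun r : ℝ => r ^ 2) (Ioi 0) := by
    intro a ha b hb hab
    exact (sq_eq_sq₀ (le_of_lt (α := ℝ) ha) (le_of_lt (α := ℝ) hb)).1 hab
  have himage : (fun r : ℝ => r ^ 2) '' Ioi 0 = Ioi 0 := by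
    ext t
    constructor
    · rintro ⟨r, hr, rfl⟩; exact pow_pos (mem_Ioi.1 hr) 2
    · intro ht
      exact ⟨√t, Real.sqrt_pos.2 ht, Real.sq_sqrt (le_of_lt (α := ℝ) ht)⟩
  have h2 := lintegral_image_eq_lintegral_abs_deriv_mul measurableSet_Ioi hderiv hinj
    (fun t => H t * ENNReal.ofReal (1 / 2 * rexp (-t / 2)))
  rw [himage] at h2
  rw [h2]
  refine setLIntegral_congr_fun measurableSet_Ioi fun r hr => ?_
  have hr0 : (0 : ℝ) < r := hr
  rw [abs_of_pos (by positivity : (0 : ℝ) < 2 * r), mul_left_comm,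
    ← ENNReal.ofReal_mul (by positivity : (0 : ℝ) ≤ 2 * r), mul_comm]
  congr 2
  ring

/-- **Archimedes' hat-box theorem, radial 2-D form.** For a standard Gaussian `x` and,
independently, `r > 0` with the law `r e^{-r²/2} dr` (the norm of a standard Gaussian of `ℝ²`),
`x/√(x² + r²)` is uniform on `[-1, 1]`:
`∫⁻ (∫⁻_{r>0} r e^{-r²/2} G(x/√(x²+r²)) dr) dγ₁(x) = ½ ∫⁻_{[-1,1]} G` for measurable `G ≥ 0`.
(The inner `dr`-integral is parenthesised: in the unparenthesised text `∫⁻ x, ∫⁻ r in s, … ∂γ₁`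
the measure `γ₁` would attach to the inner set integral and the outer one would be Lebesgue,
a different — and, for `G ≡ 1`, false — statement.) [folklore] -/
theorem radialArchimedes (G : ℝ → ℝ≥0∞) (hG : Measurable G) :
    ∫⁻ x, (∫⁻ r in Set.Ioi (0:ℝ), ENNReal.ofReal (r * Real.exp (-r ^ 2 / 2)) *
        G (x / Real.sqrt (x ^ 2 + r ^ 2))) ∂(ProbabilityTheory.gaussianReal 0 1) =
      2⁻¹ * ∫⁻ t in Set.Icc (-1 : ℝ) 1, G t := by
  rw [← lintegral_gaussianReal_stdGaussian_two_archimedes G hG]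
  refine lintegral_congr fun x => ?_
  exact (lintegral_comp_norm_sq_stdGaussian_two (fun t => G (x / √(x ^ 2 + t)))
    (hG.comp (by fun_prop))).symm

/-! ### The three-dimensional statement -/

/-- **Coordinates.** For a unit vector `e ∈ ℝ³`, in an orthonormal basis of `ℝ³` with first
vector `e` the standard Gaussian is the product of a standard Gaussian axial coordinate `x` and an
independent standard Gaussian `y ∈ ℝ²`, with `⟪e, ξ⟫ = x` and `‖ξ‖² = x² + ‖y‖²`:
`∫⁻ G(⟪e, ξ⟫/‖ξ‖) dγ(ξ) = ∫⁻∫⁻ G(x/√(x² + ‖y‖²)) dγ_{ℝ²}(y) dγ₁(x)`. [folklore] -/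
theorem lintegral_stdGaussian_cosine_eq {e : V3} (he : ‖e‖ = 1) (G : ℝ → ℝ≥0∞)
    (hG : Measurable G) :
    ∫⁻ ξ, G (⟪e, ξ⟫_ℝ / ‖ξ‖) ∂(stdGaussian V3) =
      ∫⁻ x, ∫⁻ y, G (x / √(x ^ 2 + ‖y‖ ^ 2)) ∂(stdGaussian (EuclideanSpace ℝ (Fin 2)))
        ∂(gaussianReal 0 1) := by
  -- an orthonormal basis of `ℝ³` with first vector `e`
  obtain ⟨b, hb⟩ := Orthonormal.exists_orthonormalBasis_extension_of_card_eq (𝕜 := ℝ) (E := V3)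
    (ι := Fin 3) (by simp) (v := fun _ => e) (s := {0})
    (orthonormal_subsingleton_iff.2 fun _ => he)
  have hb0 : b 0 = e := hb 0 (mem_singleton 0)
  -- Gaussian coordinates
  have hF : Measurable fun ξ : V3 => G (⟪e, ξ⟫_ℝ / ‖ξ‖) := hG.comp (by fun_prop)
  rw [stdGaussian_eq_map_pi_orthonormalBasis b, lintegral_map hF (by fun_prop)]
  have hpt : ∀ x : Fin 3 → ℝ,
      ⟪e, ∑ i, x i • b i⟫_ℝ / ‖∑ i, x i • b i‖ = x 0 / √(∑ i, x i ^ 2) := by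
    intro x
    have h1 : ∀ i, ⟪b i, ∑ j, x j • b j⟫_ℝ = x i := fun i => b.orthonormal.inner_right_fintype x i
    have h2 : ‖∑ j, x j • b j‖ ^ 2 = ∑ i, x i ^ 2 := by
      rw [← b.sum_sq_inner_right]
      simp_rw [h1]
    rw [← hb0, h1 0, ← Real.sqrt_sq (norm_nonneg (∑ j, x j • b j)), h2]
  simp_rw [hpt]
  -- split off the axial coordinate
  set e0 := MeasurableEquiv.piFinSuccAbove (fun _ : Fin 3 => ℝ) 0 with he0
  have hmp : MeasurePreserving e0 (Measure.pi fun _ : Fin 3 => gaussianReal 0 1)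
      ((gaussianReal 0 1).prod (Measure.pi fun _ : Fin 2 => gaussianReal 0 1)) :=
    measurePreserving_piFinSuccAbove (fun _ : Fin 3 => gaussianReal 0 1) 0
  have hΦ : Measurable fun x : Fin 3 → ℝ => G (x 0 / √(∑ i, x i ^ 2)) := hG.comp (by fun_prop)
  rw [← (hmp.symm e0).lintegral_comp_emb e0.symm.measurableEmbedding,
    lintegral_prod (fun p : ℝ × (Fin 2 → ℝ) => G ((e0.symm p) 0 / √(∑ i, (e0.symm p) i ^ 2)))
      ((hΦ.comp e0.symm.measurable).aemeasurable)]
  refine lintegral_congr fun x => ?_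
  have hpt2 : ∀ y : Fin 2 → ℝ,
      G ((e0.symm (x, y)) 0 / √(∑ i, (e0.symm (x, y)) i ^ 2)) =
        G (x / √(x ^ 2 + ∑ j, y j ^ 2)) := by
    intro y
    simp [he0, Fin.sum_univ_succ]
  simp_rw [hpt2]
  -- the planar Gaussian
  have hG2 : Measurable fun y : EuclideanSpace ℝ (Fin 2) => G (x / √(x ^ 2 + ‖y‖ ^ 2)) :=
    hG.comp (by fun_prop)
  conv_rhs => rw [← map_pi_eq_stdGaussian, lintegral_map hG2 (by fun_prop)]
  refine lintegral_congr fun y => ?_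
  rw [EuclideanSpace.real_norm_sq_eq]

/-- **Archimedes' hat-box theorem for the standard Gaussian of `ℝ³`** (registered stub
`stub_archimedes` of line `Sketch`, crux stmt-AtomisticToContinuum-11854). For a unit vector `e`,
the cosine `⟪e, ξ⟫/‖ξ‖` of the angle between `e` and a standard Gaussian vector `ξ` (i.e. between
`e` and a uniform point `ξ̂` of the sphere) is uniformly distributed on `[-1, 1]`:
`∫⁻ G(⟪e,ξ⟫/‖ξ‖) dγ(ξ) = ½ ∫⁻_{[-1,1]} G(t) dt` for every measurable `G ≥ 0` (the origin, where
the quotient is the junk value `0`, is `γ`-null). [folklore] -/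
theorem archimedesV3 : ∀ e : V3, ‖e‖ = 1 → ∀ G : ℝ → ℝ≥0∞, Measurable G →
    ∫⁻ ξ, G (⟪e, ξ⟫_ℝ / ‖ξ‖) ∂(stdGaussian V3) = 2⁻¹ * ∫⁻ t in Set.Icc (-1 : ℝ) 1, G t := by
  intro e he G hG
  rw [lintegral_stdGaussian_cosine_eq he G hG,
    lintegral_gaussianReal_stdGaussian_two_archimedes G hG]

/-- Registered stub `stub_archimedes` of line `Sketch` (crux stmt-AtomisticToContinuum-11854). [folklore] -/
theorem stub_archimedes :
    ∀ e : V3, ‖e‖ = 1 → ∀ G : ℝ → ℝ≥0∞, Measurable G →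
    ∫⁻ ξ, G (⟪e, ξ⟫_ℝ / ‖ξ‖) ∂(stdGaussian V3) = 2⁻¹ * ∫⁻ t in Set.Icc (-1 : ℝ) 1, G t :=
  archimedesV3

end Summit.AtomisticToContinuum.HydrodynamicLimit.Theorems.LambertianContactSwapLambertianEulerArchimedes
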